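import Summits.PneNP.PneNP.Theses.ProofCplx
import Summits.PneNP.PneNP.Theorems.ExpanderLinearGeneratorsNoPolyBoundedProofSystem
import Literature.Computability.Complexity.Nondeterministic

/-!
# Crux `ProofcplxThesis` (stmt-PneNP-0097) — ideator 4, round 2: first-lemma sketches for the
# idea card `ground-floor-linear-hierarchy` (exponent-axis floor of X).

Everything here is a STATEMENT sketch (Props + one trivial composition); nothing is claimed proved
except the propositional glue `groundFloor_of_X`.
-/

set_option linter.dupNamespace false

namespace Summit.PneNP.PneNP.Cruxes.ProofcplxThesis.GroundFloor

open Literature.Computability.Complexity Literature.Computability.MetaComplexity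
open Summit.PneNP.PneNP.Theses

/-- The crux, by its route name. -/
abbrev X : Prop := ProofCplx.ProofcplxThesis

/-- `F₀` (ground floor, exact-linear form): nondeterministic linear time on the tree's machine model
(Mathlib `FinTM2` = multi-stack = multi-pushdown machines) is not closed under complement;
equivalently the linear-time hierarchy does not collapse to its `Σ₁` level (Wrathall 1978).
Open (Book–Greibach 1970). -/
def NlinNeConlin : Prop :=
  NTIME (fun n => n) ≠ coNTIME (fun n => n)

/-- `F₁` (ground floor, quasi-linear = machine-robust form): co-nondeterministic linear time is not
inside nondeterministic quasi-linear time `n · (log n)^k`. Via Cook's `O(t log t)` formulas for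
time-`t` nondeterministic computations this is "TAUT ∉ NTIME(n · polylog n)": no proof system whose
verifier runs in quasi-linear time has quasi-linear-size proofs of all tautologies. -/
def ConlinNotInNQL : Prop :=
  ¬ (coNTIME (fun n => n) ⊆ ⋃ k : ℕ, NTIME (fun n => n * (Nat.log 2 n + 1) ^ k))

/-- FIRST LEMMA (downward translation of the collapse, by padding): if `NLIN = coNLIN` then
`NP = coNP`. Standard (Book 1974-type translational argument): pad `L ∈ coNTIME(n^k)` to a
linear-time language, complement inside `NTIME(n)`, unpad. Size M in the tree (needs an
`NTIME`-preimage-under-padding lemma in the `FinTM2` model, cf. `preimage_mem_NE_of_mem_FE`). -/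
def PaddingCollapse : Prop :=
  NTIME (fun n => n) = coNTIME (fun n => n) → Nondeterministic.NP = coNP

/-- FIRST LEMMA, quasi-linear form: if `coNTIME(n) ⊆ NQL` then `NP = coNP` (same padding argument,
one polylog factor carried along). -/
def PaddingCollapseQL : Prop :=
  (coNTIME (fun n => n) ⊆ ⋃ k : ℕ, NTIME (fun n => n * (Nat.log 2 n + 1) ^ k)) →
    Nondeterministic.NP = coNP

/-- Glue (propositional): the ground floor is a CONSEQUENCE of the crux, given the padding lemma.
So `F₀` is a necessary rung of `X` on the proof-LENGTH-EXPONENT axis (not a line on `X`). -/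
theorem groundFloor_of_X (hpad : PaddingCollapse) (hX : X) : NlinNeConlin := by
  intro hcollapse
  have hne : Nondeterministic.NP ≠ coNP :=
    (Summit.PneNP.PneNP.Theorems.noPolyBoundedProofSystem_iff_NP_ne_coNP).1 hX
  exact hne (hpad hcollapse)

/-- Same for the quasi-linear floor. -/
theorem quasiLinearFloor_of_X (hpad : PaddingCollapseQL) (hX : X) : ConlinNotInNQL := by
  intro hsub
  have hne : Nondeterministic.NP ≠ coNP :=
    (Summit.PneNP.PneNP.Theorems.noPolyBoundedProofSystem_iff_NP_ne_coNP).1 hX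
  exact hne (hpad hsub)

/-- The slowdown-free world `W` (hypothesis for the indirect diagonalization): in `W` every
bounded-alternation linear-time computation is an `NLIN` computation. Stated for the one level the
tree can express without alternating machines: `polyExists`/complement closure at linear time is
replaced by the closure of `NTIME(n)` under complement (= `¬ F₀`). A space-free speed-up
`NTIME(t) ⊆ Σₖ-TIME(o(t))` on `FinTM2` (for some fixed `k`, some time-constructible `t ≥ n`)
contradicts `W` by the `Σₖ` time hierarchy; no such speed-up is known (separators: refuted by
3-pushdown expanders, Dujmović–Sidiropoulos–Wood 2016 Thm 3; segregators: consistency,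
Santhanam 2001 §5). Recorded as a `Prop`-valued placeholder to name the missing lemma. -/
def SpaceFreeNondeterministicSpeedup : Prop :=
  ∃ t : ℕ → ℕ, (∀ n, n ≤ t n) ∧ ∃ s : ℕ → ℕ, (∀ c : ℕ, ∀ᶠ n in Filter.atTop, c * s n ≤ t n) ∧
    NTIME t ⊆ polyExists (co (polyExists (co (NTIME s))))
  -- shape only: "NTIME(t) ⊆ Σ₃-type closure of NTIME(o(t))"; the honest statement needs
  -- linear-witness (not poly-witness) operators, which the tree does not have yet (definition item).

end Summit.PneNP.PneNP.Cruxes.ProofcplxThesis.GroundFloor
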